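import Summits.NavierStokesRegularity.NavierStokesRegularity.Theorems.ScenarioCensusRowF1EventSocketTransfer
import Summits.NavierStokesRegularity.NavierStokesRegularity.Theorems.ScenarioCensusRowF1EventSocketEvents
import HarnessLib

/-!
# LINE 30 «event-socket» port, part 4/4: §8 THE NAMED ROWS, FLOORS AND RESIDUALS of the three instances (`Row_F1strTh` / `Row_F1strVo` / `Row_F1xfTh` / `Row_F1xfVo`,
# `Row_F1spdTh`; floors; residuals ≡ `Row_F1`; summary); census KEYS `Row_F1strTh` / `Row_F1strVo` / `Row_F1xfTh` / `Row_F1xfVo` + `_excluded`, floors, edges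

Re-homed for the scenario census (typer seat ns-census-typer-1 g9; the cells F1Σth / F1Σvo / F1Ξth / F1Ξvo (+ generic F1[P]th/vo) and the floors RΣS / PΣS / RΞS /
PΞS are MEMBERS OF RECORD «DECIDED IN KERNEL IN FILES» of row F1 since census v1.92 (critic idea-crit-3 g8 PASS 06:47:48Z — no price; ref ns-census-ref g11 PRE-CHECK ✓
§16.30 item 58; lead-presearch label item 58); this port makes them TREE-decided): VERBATIM PORT of the NEW sections (§6–§8) of ns-idea-3 LINE 30 «event-socket»,
`pub/ideators/ns-idea-3/lines/event-socket/line-event-socket.lean` sha16 6529f3492cb49b94 (1484 l., lean check rc 0, 0 sorry; its §1–§5 = LINE 27/28/29 VERBATIM,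
taken BY NAME from `ScenarioCensusRowF1Socket*` / `…SharpTop*` / `…ThinTop*`), split for the 400-line rule into `ScenarioCensusRowF1EventSocket` (§6 vocabulary) →
`…EventSocketTransfer` (§6 transfer + engine) → `…EventSocketEvents` (§7) → `…EventSocketRows` (§8 + census KEYS).  Lean text VERBATIM in namespace
`…Theorems.ScenarioCensus.EventSocket` (the line's `…Cruxes.ScenarioCensusRowF1.EventSocketLine` re-homed) with `open …LiouvilleSocket …SharpTop …ThinTop`; port
edits: `@[conjecture]` on the residuals `StretchSlack` / `CrossFlowSlack` (≡ `ScenarioCensus.Row_F1`, OPEN), one-line docstrings added where missing (gate lint); `cross_smul_smul` is the tree's `UnthreadedRigidity.ThreadingJets.cross_smul_smul` taken BY NAME (review p713151).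
Statements untouched.

No census VALUE is moved here (row F1 stays OPEN-WITH-LINE; the members become TREE-decided by name); NS regularity is NOT proved; `Row_F1` is untouched (zero
movement, `evSlack_iff_rowF1` / `stretchSlack_iff_rowF1` / `crossFlowSlack_iff_rowF1`); no summit statement is proved by this file. Lemmas that restate already-landed tree declarations are taken BY NAME (gate lint `dedup.landed`): `fderiv_smul_stPull_apply` = `InviscidTop.fderiv_smul_stPull_apply`, `fderiv_smul_stPull` = `InviscidTop.fderiv_smul_stPull`, `fderiv_fderiv_smul_stPull` = `InviscidTop.fderiv_fderiv_smul_stPull`, `tendsto_clm_of_tendsto_apply` = `InviscidTop.tendsto_clm_of_tendsto_apply`, `tendsto_fderiv_fderiv_apply_of_bound` = `InviscidTop.tendsto_fderiv_fderiv_apply_of_bound`, `tendsto_fderiv_fderiv_of_bound` = `InviscidTop.tendsto_fderiv_fderiv_of_bound`, `tendsto_fderiv_fderiv_of_typeI_seq_Ioo` = `InviscidTop.tendsto_fderiv_fderiv_of_typeI_seq_Ioo`, `fderiv3_smul_stPull` = `FrozenTop.fderiv3_smul_stPull`, `tendsto_fderiv3_of_typeI_seq_Ioo` = `FrozenTop.tendsto_fderiv3_of_typeI_seq_Ioo`,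 `tendsto_physicalTime` = `ColumnarTop.tendsto_physicalTime`, `eventually_fast` = `ColumnarTop.eventually_fast`, `sqrt_timeLag` = `StretchedTop.sqrt_timeLag`, `forall_of_forall_ne_zero` = `StretchedTop.forall_of_forall_ne_zero`, `radius_eq` = `FrozenTop.radius_eq`, `jointCond_everywhere₆` = `FrozenTop.jointCond_everywhere₄`, `continuousOn_quad` = `IntegratedStretch.continuousOn_quad`, `sqrt_nu_timeLag` = `IntegratedStretch.sqrt_nu_timeLag`, `sing_of_not_bounded` = `InviscidTop.sing_of_not_bounded`, `exists_singularZoom_package₃` = `FrozenTop.exists_singularZoom_package₃`, `lapD_eq_zero_of_eq_zero` = `FrozenTop.lapD_eq_zero_of_eq_zero`, `measurableSet_top` = `IntegratedStretch.measurableSet_top`, `cross_smul_smul` = `UnthreadedRigidity.ThreadingJets.cross_smul_smul`.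
-/

-- the summit and its single problem share the name `NavierStokesRegularity` (D-0017 nested layout)
set_option linter.dupNamespace false

noncomputable section

open MeasureTheory Set Function Filter TopologicalSpace Metric
open scoped Topology NNReal ENNReal InnerProductSpace RealInnerProductSpace Laplacian

namespace Summit.NavierStokesRegularity.NavierStokesRegularity.Theorems.ScenarioCensus.EventSocket

open Literature.Analysis Literature.Analysis.FluidPDE
open Summit.NavierStokesRegularity.NavierStokesRegularity.Theorems
open Summit.NavierStokesRegularity.NavierStokesRegularity.Theorems.ScenarioCensus.LiouvilleSocket
open Summit.NavierStokesRegularity.NavierStokesRegularity.Theorems.ScenarioCensus.SharpTop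
open Summit.NavierStokesRegularity.NavierStokesRegularity.Theorems.ScenarioCensus.ThinTop

/-! ## §8 THE NAMED ROWS, FLOORS AND RESIDUALS of the three instances (all rows and floors PROVED; residuals ≡ `Row_F1`) -/

/-! ### Stretching: «THIN STRETCHED TOP» / «EVANESCENT STRETCHED TOP», floors, residual -/

/-- **Criterion row F1Σth «THIN STRETCHED TOP»** (NEW; order 1, magnitude-blind, `ν`-free event): in the frame of `Row_F1`,
if for some `θ < 1` and every `δ > 0` the times at which the set `{x : θ‖ω‖² < (T − t)⟪∇u ω, ω⟫}` («super-critically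
stretched points») has volume `> δ(ν(T − t))^{3/2}` are SCALE-NULL at `T`, then the solution extends past `T`. -/
def Row_F1strTh : Prop :=
  ∀ (ν T : ℝ), 0 < ν → 0 < T → ∀ (u : ℝ → E3 → E3) (p : ℝ → E3 → ℝ),
    IsClassicalNSSolutionOn (Ico 0 T) ν 0 u p → IsLerayHopfOn T ν 0 (u 0) u → HasRapidSpatialDecay (u 0) →
    IsTypeIBlowup u T →
    (∃ θ : ℝ, θ < 1 ∧ ∀ δ : ℝ, 0 < δ → IsScaleNull T (evFatTimes (StretchEv θ) T ν δ u)) →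
    HasSmoothExtensionPast ν 0 u T

/-- **Criterion row F1Σvo «EVANESCENT STRETCHED TOP»** (NEW): `Φ_{Σ_θ}(t) → 0` as `t ↑ T` for some `θ < 1` suffices. -/
def Row_F1strVo : Prop :=
  ∀ (ν T : ℝ), 0 < ν → 0 < T → ∀ (u : ℝ → E3 → E3) (p : ℝ → E3 → ℝ),
    IsClassicalNSSolutionOn (Ico 0 T) ν 0 u p → IsLerayHopfOn T ν 0 (u 0) u → HasRapidSpatialDecay (u 0) →
    IsTypeIBlowup u T →
    (∃ θ : ℝ, θ < 1 ∧ Tendsto (evFraction (StretchEv θ) T ν u) (𝓝[<] T) (𝓝 0)) →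
    HasSmoothExtensionPast ν 0 u T

/-- **Floor «STRETCHED SLICES RECUR»** (NEW necessary feature of Type-I blow-up): for EVERY `θ < 1` some `δ`-fat set of
super-critically-stretched times is NOT scale-null at `T` — vortex stretching at rate `> θ/(T − t)` along the vorticity
occupies a MACROSCOPIC (parabolic-volume) portion of space on a RECURRENT (scale-window-dense) set of times. -/
def RecurrentStretchedSlices : Prop :=
  ∀ (ν T : ℝ), 0 < ν → 0 < T → ∀ (u : ℝ → E3 → E3) (p : ℝ → E3 → ℝ),
    IsMaximalSmoothSolution ν 0 u p T → IsLerayHopfOn T ν 0 (u 0) u → HasRapidSpatialDecay (u 0) →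
    IsTypeIBlowup u T → ∀ θ : ℝ, θ < 1 → ∃ δ : ℝ, 0 < δ ∧ ¬ IsScaleNull T (evFatTimes (StretchEv θ) T ν δ u)

/-- **Floor «THE STRETCHED SLICE DOES NOT EVANESCE»** (NEW): for every `θ < 1`, `Φ_{Σ_θ}(t) ↛ 0`. -/
def PersistentStretchedSlice : Prop :=
  ∀ (ν T : ℝ), 0 < ν → 0 < T → ∀ (u : ℝ → E3 → E3) (p : ℝ → E3 → ℝ),
    IsMaximalSmoothSolution ν 0 u p T → IsLerayHopfOn T ν 0 (u 0) u → HasRapidSpatialDecay (u 0) →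
    IsTypeIBlowup u T → ∀ θ : ℝ, θ < 1 → ¬ Tendsto (evFraction (StretchEv θ) T ν u) (𝓝[<] T) (𝓝 0)

/-- **Residual «STRETCH SLACK»** (≡ `Row_F1`, `stretchSlack_iff_rowF1`; not claimed): a maximal Type-I blow-up has, for some
`θ < 1`, scale-null fat stretched times for every `δ`. -/
@[conjecture] def StretchSlack : Prop :=
  ∀ (ν T : ℝ), 0 < ν → 0 < T → ∀ (u : ℝ → E3 → E3) (p : ℝ → E3 → ℝ),
    IsMaximalSmoothSolution ν 0 u p T → IsLerayHopfOn T ν 0 (u 0) u → HasRapidSpatialDecay (u 0) →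
    IsTypeIBlowup u T → ∃ θ : ℝ, θ < 1 ∧ ∀ δ : ℝ, 0 < δ → IsScaleNull T (evFatTimes (StretchEv θ) T ν δ u)

/-- **Row F1Σth holds** (thin stretched top). -/
theorem rowF1strTh_holds : Row_F1strTh := by
  intro ν T hν hT u p hsol hLH hdec hTI h
  obtain ⟨θ, hθ, hnull⟩ := h
  exact evRow_of_kills (isOpen_stretchEv θ) (eventKills_stretchEv hθ) ν T hν hT u p hsol hLH hdec hTI hnull

/-- **Row F1Σvo holds** (evanescent stretched top). -/
theorem rowF1strVo_holds : Row_F1strVo := by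
  intro ν T hν hT u p hsol hLH hdec hTI h
  obtain ⟨θ, hθ, hlim⟩ := h
  exact evRowVo_of_kills (isOpen_stretchEv θ) (eventKills_stretchEv hθ) ν T hν hT u p hsol hLH hdec hTI hlim

/-- Hypothesis classes: thin stretched top ⇒ evanescent stretched top (as rows). -/
theorem rowF1strVo_of_rowF1strTh (h : Row_F1strTh) : Row_F1strVo := by
  intro ν T hν hT u p hsol hLH hdec hTI hyp
  obtain ⟨θ, hθ, hlim⟩ := hyp
  exact h ν T hν hT u p hsol hLH hdec hTI ⟨θ, hθ, fun δ hδ => isScaleNull_evFatTimes_of_tendsto_zero hν hT hlim hδ⟩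

/-- **Floor RΣS holds** (recurrent stretched slices). -/
theorem recurrentStretchedSlices_holds : RecurrentStretchedSlices :=
  fun ν T hν hT u p hmax hLH hdec hTI θ hθ =>
    evFloor_of_kills (isOpen_stretchEv θ) (eventKills_stretchEv hθ) ν T hν hT u p hmax hLH hdec hTI

/-- **Floor PΣS holds** (persistent stretched slice). -/
theorem persistentStretchedSlice_holds : PersistentStretchedSlice :=
  fun ν T hν hT u p hmax hLH hdec hTI θ hθ =>
    evFloorVo_of_kills (isOpen_stretchEv θ) (eventKills_stretchEv hθ) ν T hν hT u p hmax hLH hdec hTI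

/-- The split through the stretching instance: row + slack ⇒ `Row_F1`. -/
theorem rowF1_of_stretch (hR : Row_F1strTh) (hS : StretchSlack) : ScenarioCensus.Row_F1 := by
  unfold ScenarioCensus.Row_F1
  intro ν T hν hT u p hsol hLH hdec hTI
  by_contra hext
  exact hext (hR ν T hν hT u p hsol hLH hdec hTI (hS ν T hν hT u p ⟨hsol, hext⟩ hLH hdec hTI))

/-- `Row_F1` gives the stretching slack. -/
theorem stretchSlack_of_rowF1 (h : ScenarioCensus.Row_F1) : StretchSlack :=
  fun ν T hν hT u p hmax hLH hdec hTI => absurd (h ν T hν hT u p hmax.1 hLH hdec hTI) hmax.2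

/-- The stretching residual is EXACTLY `Row_F1`. -/
theorem stretchSlack_iff_rowF1 : StretchSlack ↔ ScenarioCensus.Row_F1 :=
  ⟨rowF1_of_stretch rowF1strTh_holds, stretchSlack_of_rowF1⟩

/-! ### Cross-flow: «THIN CROSS-FLOW TOP» / «EVANESCENT CROSS-FLOW TOP», floors, residual -/

/-- **Criterion row F1𝒳th «THIN CROSS-FLOW TOP»** (NEW; order 1, magnitude-blind): in the frame of `Row_F1`, if for some
`θ < 1` and every `δ > 0` the times at which `{x : θ‖ω‖ < √((T − t)/ν)‖ω × u‖}` («super-critical Lamb vector») has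
volume `> δ(ν(T − t))^{3/2}` are SCALE-NULL at `T`, then the solution extends past `T`. -/
def Row_F1xfTh : Prop :=
  ∀ (ν T : ℝ), 0 < ν → 0 < T → ∀ (u : ℝ → E3 → E3) (p : ℝ → E3 → ℝ),
    IsClassicalNSSolutionOn (Ico 0 T) ν 0 u p → IsLerayHopfOn T ν 0 (u 0) u → HasRapidSpatialDecay (u 0) →
    IsTypeIBlowup u T →
    (∃ θ : ℝ, θ < 1 ∧ ∀ δ : ℝ, 0 < δ → IsScaleNull T (evFatTimes (CrossEv θ) T ν δ u)) →
    HasSmoothExtensionPast ν 0 u T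

/-- **Criterion row F1𝒳vo «EVANESCENT CROSS-FLOW TOP»** (NEW): `Φ_{𝒳_θ}(t) → 0` for some `θ < 1` suffices. -/
def Row_F1xfVo : Prop :=
  ∀ (ν T : ℝ), 0 < ν → 0 < T → ∀ (u : ℝ → E3 → E3) (p : ℝ → E3 → ℝ),
    IsClassicalNSSolutionOn (Ico 0 T) ν 0 u p → IsLerayHopfOn T ν 0 (u 0) u → HasRapidSpatialDecay (u 0) →
    IsTypeIBlowup u T →
    (∃ θ : ℝ, θ < 1 ∧ Tendsto (evFraction (CrossEv θ) T ν u) (𝓝[<] T) (𝓝 0)) →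
    HasSmoothExtensionPast ν 0 u T

/-- **Floor «CROSS-FLOW SLICES RECUR»** (NEW): for every `θ < 1` some `δ`-fat set of super-critical-Lamb-vector times is not
scale-null at `T`. -/
def RecurrentCrossFlowSlices : Prop :=
  ∀ (ν T : ℝ), 0 < ν → 0 < T → ∀ (u : ℝ → E3 → E3) (p : ℝ → E3 → ℝ),
    IsMaximalSmoothSolution ν 0 u p T → IsLerayHopfOn T ν 0 (u 0) u → HasRapidSpatialDecay (u 0) →
    IsTypeIBlowup u T → ∀ θ : ℝ, θ < 1 → ∃ δ : ℝ, 0 < δ ∧ ¬ IsScaleNull T (evFatTimes (CrossEv θ) T ν δ u)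

/-- **Floor «THE CROSS-FLOW SLICE DOES NOT EVANESCE»** (NEW): for every `θ < 1`, `Φ_{𝒳_θ}(t) ↛ 0`. -/
def PersistentCrossFlowSlice : Prop :=
  ∀ (ν T : ℝ), 0 < ν → 0 < T → ∀ (u : ℝ → E3 → E3) (p : ℝ → E3 → ℝ),
    IsMaximalSmoothSolution ν 0 u p T → IsLerayHopfOn T ν 0 (u 0) u → HasRapidSpatialDecay (u 0) →
    IsTypeIBlowup u T → ∀ θ : ℝ, θ < 1 → ¬ Tendsto (evFraction (CrossEv θ) T ν u) (𝓝[<] T) (𝓝 0)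

/-- **Residual «CROSS-FLOW SLACK»** (≡ `Row_F1`; not claimed). -/
@[conjecture] def CrossFlowSlack : Prop :=
  ∀ (ν T : ℝ), 0 < ν → 0 < T → ∀ (u : ℝ → E3 → E3) (p : ℝ → E3 → ℝ),
    IsMaximalSmoothSolution ν 0 u p T → IsLerayHopfOn T ν 0 (u 0) u → HasRapidSpatialDecay (u 0) →
    IsTypeIBlowup u T → ∃ θ : ℝ, θ < 1 ∧ ∀ δ : ℝ, 0 < δ → IsScaleNull T (evFatTimes (CrossEv θ) T ν δ u)

/-- **Row F1Ξth holds** (thin cross-flow top). -/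
theorem rowF1xfTh_holds : Row_F1xfTh := by
  intro ν T hν hT u p hsol hLH hdec hTI h
  obtain ⟨θ, hθ, hnull⟩ := h
  exact evRow_of_kills (isOpen_crossEv θ) (eventKills_crossEv hθ) ν T hν hT u p hsol hLH hdec hTI hnull

/-- **Row F1Ξvo holds** (evanescent cross-flow top). -/
theorem rowF1xfVo_holds : Row_F1xfVo := by
  intro ν T hν hT u p hsol hLH hdec hTI h
  obtain ⟨θ, hθ, hlim⟩ := h
  exact evRowVo_of_kills (isOpen_crossEv θ) (eventKills_crossEv hθ) ν T hν hT u p hsol hLH hdec hTI hlim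

/-- Hypothesis classes: thin cross-flow top ⇒ evanescent cross-flow top (as rows). -/
theorem rowF1xfVo_of_rowF1xfTh (h : Row_F1xfTh) : Row_F1xfVo := by
  intro ν T hν hT u p hsol hLH hdec hTI hyp
  obtain ⟨θ, hθ, hlim⟩ := hyp
  exact h ν T hν hT u p hsol hLH hdec hTI ⟨θ, hθ, fun δ hδ => isScaleNull_evFatTimes_of_tendsto_zero hν hT hlim hδ⟩

/-- **Floor RΞS holds** (recurrent cross-flow slices). -/
theorem recurrentCrossFlowSlices_holds : RecurrentCrossFlowSlices :=
  fun ν T hν hT u p hmax hLH hdec hTI θ hθ =>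
    evFloor_of_kills (isOpen_crossEv θ) (eventKills_crossEv hθ) ν T hν hT u p hmax hLH hdec hTI

/-- **Floor PΞS holds** (persistent cross-flow slice). -/
theorem persistentCrossFlowSlice_holds : PersistentCrossFlowSlice :=
  fun ν T hν hT u p hmax hLH hdec hTI θ hθ =>
    evFloorVo_of_kills (isOpen_crossEv θ) (eventKills_crossEv hθ) ν T hν hT u p hmax hLH hdec hTI

/-- The split through the cross-flow instance: row + slack ⇒ `Row_F1`. -/
theorem rowF1_of_crossFlow (hR : Row_F1xfTh) (hS : CrossFlowSlack) : ScenarioCensus.Row_F1 := by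
  unfold ScenarioCensus.Row_F1
  intro ν T hν hT u p hsol hLH hdec hTI
  by_contra hext
  exact hext (hR ν T hν hT u p hsol hLH hdec hTI (hS ν T hν hT u p ⟨hsol, hext⟩ hLH hdec hTI))

/-- `Row_F1` gives the cross-flow slack. -/
theorem crossFlowSlack_of_rowF1 (h : ScenarioCensus.Row_F1) : CrossFlowSlack :=
  fun ν T hν hT u p hmax hLH hdec hTI => absurd (h ν T hν hT u p hmax.1 hLH hdec hTI) hmax.2

/-- The cross-flow residual is EXACTLY `Row_F1`. -/
theorem crossFlowSlack_iff_rowF1 : CrossFlowSlack ↔ ScenarioCensus.Row_F1 :=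
  ⟨rowF1_of_crossFlow rowF1xfTh_holds, crossFlowSlack_of_rowF1⟩

/-! ### Speed: the socket recovers LINE 29's apex row «THIN TOP» and floor «FAT FAST SLICES RECUR» (identification) -/

/-- **Row F1th «THIN TOP» in event language** (LINE 29's apex row; here an INSTANCE of the socket, recorded for
identification — not a new row). -/
def Row_F1spdTh : Prop :=
  ∀ (ν T : ℝ), 0 < ν → 0 < T → ∀ (u : ℝ → E3 → E3) (p : ℝ → E3 → ℝ),
    IsClassicalNSSolutionOn (Ico 0 T) ν 0 u p → IsLerayHopfOn T ν 0 (u 0) u → HasRapidSpatialDecay (u 0) →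
    IsTypeIBlowup u T →
    (∃ κ : ℝ, κ < 1 ∧ ∀ δ : ℝ, 0 < δ → IsScaleNull T (evFatTimes (SpeedEv κ) T ν δ u)) →
    HasSmoothExtensionPast ν 0 u T

/-- LINE 29's floor in event language. -/
def RecurrentFastSlices' : Prop :=
  ∀ (ν T : ℝ), 0 < ν → 0 < T → ∀ (u : ℝ → E3 → E3) (p : ℝ → E3 → ℝ),
    IsMaximalSmoothSolution ν 0 u p T → IsLerayHopfOn T ν 0 (u 0) u → HasRapidSpatialDecay (u 0) →
    IsTypeIBlowup u T → ∀ κ : ℝ, κ < 1 → ∃ δ : ℝ, 0 < δ ∧ ¬ IsScaleNull T (evFatTimes (SpeedEv κ) T ν δ u)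

/-- **Row F1spdTh holds** (the speed instance: LINE 29's apex row in socket form). -/
theorem rowF1spdTh_holds : Row_F1spdTh := by
  intro ν T hν hT u p hsol hLH hdec hTI h
  obtain ⟨κ, hκ, hnull⟩ := h
  exact evRow_of_kills (isOpen_speedEv κ) (eventKills_speedEv hκ) ν T hν hT u p hsol hLH hdec hTI hnull

/-- **Floor: fat fast slices recur** (socket form). -/
theorem recurrentFastSlices'_holds : RecurrentFastSlices' :=
  fun ν T hν hT u p hmax hLH hdec hTI κ hκ =>
    evFloor_of_kills (isOpen_speedEv κ) (eventKills_speedEv hκ) ν T hν hT u p hmax hLH hdec hTI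

/-! ### Summary -/

/-- **The socket's output in one line**: three open killing events, three excluded apex rows, three floors; every
residual is `Row_F1`.  No summit is proved. -/
theorem eventSocket_summary :
    Row_F1strTh ∧ Row_F1xfTh ∧ Row_F1spdTh ∧ RecurrentStretchedSlices ∧ RecurrentCrossFlowSlices ∧ RecurrentFastSlices' ∧
      (StretchSlack ↔ ScenarioCensus.Row_F1) ∧ (CrossFlowSlack ↔ ScenarioCensus.Row_F1) :=
  ⟨rowF1strTh_holds, rowF1xfTh_holds, rowF1spdTh_holds, recurrentStretchedSlices_holds, recurrentCrossFlowSlices_holds,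
    recurrentFastSlices'_holds, stretchSlack_iff_rowF1, crossFlowSlack_iff_rowF1⟩

end Summit.NavierStokesRegularity.NavierStokesRegularity.Theorems.ScenarioCensus.EventSocket

namespace Summit.NavierStokesRegularity.NavierStokesRegularity.Theorems.ScenarioCensus

/-! ## Census KEYS (ns `…Theorems.ScenarioCensus`): the EVENT-SOCKET members of row F1 (LINE 30) — TREE-decided F1Σth / F1Σvo / F1Ξth / F1Ξvo and floors RΣS / PΣS / RΞS / PΞS -/

/-- **Cell F1Σth «THIN STRETCHED TOP»** (row F1 frame VERBATIM + for some `θ < 1` and every `δ > 0` the `δ`-fat times of the scale-invariant stretching-event slice are scale-null at `T`): `:= EventSocket.Row_F1strTh`. DECIDED. -/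
def Row_F1strTh : Prop := EventSocket.Row_F1strTh
/-- F1strTh is EXCLUDED (decided in the tree): `EventSocket.rowF1strTh_holds`. -/
theorem row_F1strTh_excluded : Row_F1strTh := EventSocket.rowF1strTh_holds

/-- **Cell F1Σvo «EVANESCENT STRETCHED TOP»** (the stretching-event slice fraction tends to `0`): `:= EventSocket.Row_F1strVo`. DECIDED. -/
def Row_F1strVo : Prop := EventSocket.Row_F1strVo
/-- F1strVo is EXCLUDED (decided in the tree): `EventSocket.rowF1strVo_holds`. -/
theorem row_F1strVo_excluded : Row_F1strVo := EventSocket.rowF1strVo_holds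

/-- **Cell F1Ξth «THIN CROSS-FLOW TOP»** (scale-null fat times of the cross-flow-event slice): `:= EventSocket.Row_F1xfTh`. DECIDED. -/
def Row_F1xfTh : Prop := EventSocket.Row_F1xfTh
/-- F1xfTh is EXCLUDED (decided in the tree): `EventSocket.rowF1xfTh_holds`. -/
theorem row_F1xfTh_excluded : Row_F1xfTh := EventSocket.rowF1xfTh_holds

/-- **Cell F1Ξvo «EVANESCENT CROSS-FLOW TOP»**: `:= EventSocket.Row_F1xfVo`. DECIDED. -/
def Row_F1xfVo : Prop := EventSocket.Row_F1xfVo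
/-- F1xfVo is EXCLUDED (decided in the tree): `EventSocket.rowF1xfVo_holds`. -/
theorem row_F1xfVo_excluded : Row_F1xfVo := EventSocket.rowF1xfVo_holds

/-- **Floor RΣS — RECURRENT STRETCHED SLICES**: `EventSocket.recurrentStretchedSlices_holds`. -/
theorem row_F1_recurrentStretchedSlices : EventSocket.RecurrentStretchedSlices := EventSocket.recurrentStretchedSlices_holds
/-- **Floor PΣS — PERSISTENT STRETCHED SLICE**: `EventSocket.persistentStretchedSlice_holds`. -/
theorem row_F1_persistentStretchedSlice : EventSocket.PersistentStretchedSlice := EventSocket.persistentStretchedSlice_holds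
/-- **Floor RΞS — RECURRENT CROSS-FLOW SLICES**: `EventSocket.recurrentCrossFlowSlices_holds`. -/
theorem row_F1_recurrentCrossFlowSlices : EventSocket.RecurrentCrossFlowSlices := EventSocket.recurrentCrossFlowSlices_holds
/-- **Floor PΞS — PERSISTENT CROSS-FLOW SLICE**: `EventSocket.persistentCrossFlowSlice_holds`. -/
theorem row_F1_persistentCrossFlowSlice : EventSocket.PersistentCrossFlowSlice := EventSocket.persistentCrossFlowSlice_holds
/-- The SPEED instance recovers LINE 29's apex row in socket form (`EventSocket.rowF1spdTh_holds`; identification with `Row_F1th` is semantic). -/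
theorem row_F1_spdTh : EventSocket.Row_F1spdTh := EventSocket.rowF1spdTh_holds
/-- Lattice edges at key level: F1Σth ⇒ F1Σvo, F1Ξth ⇒ F1Ξvo (`EventSocket.rowF1strVo_of_rowF1strTh` / `rowF1xfVo_of_rowF1xfTh`). -/
theorem rowF1strVo_of_rowF1strTh : Row_F1strTh → Row_F1strVo := EventSocket.rowF1strVo_of_rowF1strTh
/-- See `rowF1strVo_of_rowF1strTh`. -/
theorem rowF1xfVo_of_rowF1xfTh : Row_F1xfTh → Row_F1xfVo := EventSocket.rowF1xfVo_of_rowF1xfTh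

end Summit.NavierStokesRegularity.NavierStokesRegularity.Theorems.ScenarioCensus

end
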